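import Summits.CriticalPhenomena.PercolationContinuityZ3.Theorems.PercNonProliferationFreeBoxPowerSavingSubBoxesSuperadditive
import Summits.CriticalPhenomena.PercolationContinuityZ3.Theorems.PercNonProliferationFreeBoxPowerSavingPairSumShift
import HarnessLib

/-!
# Crux `PercNonProliferation.FreeBoxPowerSaving` (stmt-CriticalPhenomena-4447), line `Sketch-r2-ideator5`
# (card `subcritical-runaway-closure`) — stub `stub_interfaceCrossMass`

Helper file for the checked skeleton of the crux `FreeBoxPowerSaving` (route
`PercNonProliferation`), line `Sketch-r2-ideator5`.  Proves exactly the registered stub signature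
`stub_interfaceCrossMass` (the ONE-INTERFACE cross-mass lemma feeding `stub_straddlingGain`);
lands with `--supports stmt-CriticalPhenomena-4447`.

## The statement

Bond percolation `P_p` on `ℤ³`, `B(n) = box 3 n = [-n, n]³`, big box `B(3n+1)`, sub-box offsets
`c_v = (2n+1)(v - 1)` coordinatewise, `v ∈ {0, 1, 2}³` (the 27 translates `c_v + B(n)` tile
`B(3n+1)`, see `SubBoxesSuperadditive`).  Fix a direction `i` and a block `v` with `v_i ≤ 1`, so that
the neighbouring block `c_v + (2n+1) e_i + B(n)` also lies in `B(3n+1)`.  The trans-equatorial pair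
mass of ONE free box,
`X^{(i)}(n) = Σ_{x ∈ B(n), x_i ≤ -1} Σ_{y ∈ B(n), 0 ≤ y_i} P_p(x ↔ y inside B(n))`,
is at most the cross mass between the two neighbouring blocks inside the big box:
`X^{(i)}(n) ≤ Σ_{x, y ∈ B(n)} P_p(x + c_v ↔ y + c_v + (2n+1) e_i inside B(3n+1))`.

## The argument (one translation, one monotonicity, Finset bookkeeping; every `p`)

1. With the straddling offset `c' = c_v + (n+1) e_i`: termwise
   `P_p(x ↔ y in B(n)) = P_p(x + c' ↔ y + c' in B(n) + c')` (translation invariance,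
   `PairSumShift.real_openConnIn_add_box`) `≤ P_p(x + c' ↔ y + c' in B(3n+1))` (`openConnIn_mono`,
   because `B(n) + c' ⊆ B(3n+1)` when `v_i ≤ 1`, `add_straddle_mem_box`).
2. Re-index: `x + c' = (x + (n+1) e_i) + c_v` and `y + c' = (y - n e_i) + (c_v + (2n+1) e_i)`, and
   `x ↦ x + (n+1) e_i`, `y ↦ y - n e_i` map `{x ∈ B(n) : x_i ≤ -1}`, `{y ∈ B(n) : 0 ≤ y_i}`
   injectively into `B(n)` (`add_up_mem_box`, `add_down_mem_box`); dropping the remaining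
   (non-negative) terms gives the claim (`SubBoxesSuperadditive.sum_comp_le_of_injOn`, inner sum then
   outer sum, packaged once as `cross_sum_le`).

No new definitions.
-/

noncomputable section

open MeasureTheory
open Literature.Probability.Percolation Literature.Probability.LatticeModels
open scoped BigOperators

namespace Summit.CriticalPhenomena.PercolationContinuityZ3.FreeBoxPowerSavingLine

open SubBoxesSuperadditive

namespace InterfaceCrossMass

/-- **Cross sums after a straddling translation (abstract form).**  For bond percolation `P_p` on
`ℤ³`, finite sets `s, t` of sites, block offsets `a, b`, re-indexing shifts `σ, τ` and a common
translation `c'` with `σ + a = c' = τ + b`, such that `s + σ ⊆ B(m)`, `t + τ ⊆ B(m)` and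
`B(m) + c' ⊆ B(N)`:
`Σ_{x ∈ s} Σ_{y ∈ t} P_p(x ↔ y in B(m)) ≤ Σ_{x, y ∈ B(m)} P_p(x + a ↔ y + b in B(N))`
(translate by `c'`, enlarge the ambient set, re-index injectively, drop non-negative terms;
Grimmett 1999, §1.6). [folklore] -/
theorem cross_sum_le (p : unitInterval) {m N : ℕ} (s t : Finset (Site 3)) (a b σ τ c' : Site 3)
    (hσ : ∀ x ∈ s, x + σ ∈ box 3 m) (hτ : ∀ y ∈ t, y + τ ∈ box 3 m)
    (hσa : σ + a = c') (hτb : τ + b = c')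
    (hc' : ∀ w ∈ box 3 m, w + c' ∈ box 3 N) :
    ∑ x ∈ s, ∑ y ∈ t,
        (bondPercolation (zdGraph 3) p).real (openConnIn (↑(box 3 m) : Set (Site 3)) x y) ≤
      ∑ x ∈ box 3 m, ∑ y ∈ box 3 m,
        (bondPercolation (zdGraph 3) p).real
          (openConnIn (↑(box 3 N) : Set (Site 3)) (x + a) (y + b)) := by
  have himg : (fun w : Site 3 => w + c') '' (↑(box 3 m) : Set (Site 3)) ⊆ ↑(box 3 N) := by
    rintro _ ⟨w, hw, rfl⟩
    exact Finset.mem_coe.2 (hc' w (Finset.mem_coe.1 hw))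
  have hxa : ∀ x : Site 3, x + c' = x + σ + a := fun x => by rw [add_assoc, hσa]
  have hyb : ∀ y : Site 3, y + c' = y + τ + b := fun y => by rw [add_assoc, hτb]
  calc ∑ x ∈ s, ∑ y ∈ t,
          (bondPercolation (zdGraph 3) p).real (openConnIn (↑(box 3 m) : Set (Site 3)) x y)
      = ∑ x ∈ s, ∑ y ∈ t, (bondPercolation (zdGraph 3) p).real
          (openConnIn ((fun w : Site 3 => w + c') '' (↑(box 3 m) : Set (Site 3)))
            (x + c') (y + c')) := by
        refine Finset.sum_congr rfl fun x _ => Finset.sum_congr rfl fun y _ => ?_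
        exact (PairSumShift.real_openConnIn_add_box p m c' x y).symm
    _ ≤ ∑ x ∈ s, ∑ y ∈ t, (bondPercolation (zdGraph 3) p).real
          (openConnIn (↑(box 3 N) : Set (Site 3)) (x + σ + a) (y + τ + b)) := by
        refine Finset.sum_le_sum fun x _ => Finset.sum_le_sum fun y _ => ?_
        rw [← hxa, ← hyb]
        exact measureReal_mono (openConnIn_mono himg _ _) (measure_ne_top _ _)
    _ ≤ ∑ x ∈ s, ∑ y ∈ box 3 m, (bondPercolation (zdGraph 3) p).real
          (openConnIn (↑(box 3 N) : Set (Site 3)) (x + σ + a) (y + b)) := by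
        refine Finset.sum_le_sum fun x _ => ?_
        exact sum_comp_le_of_injOn t (box 3 m) (fun y => y + τ)
          (fun y => (bondPercolation (zdGraph 3) p).real
            (openConnIn (↑(box 3 N) : Set (Site 3)) (x + σ + a) (y + b)))
          (fun _ _ => measureReal_nonneg) hτ (fun y _ y' _ h => add_right_cancel h)
    _ ≤ ∑ x ∈ box 3 m, ∑ y ∈ box 3 m, (bondPercolation (zdGraph 3) p).real
          (openConnIn (↑(box 3 N) : Set (Site 3)) (x + a) (y + b)) :=
        sum_comp_le_of_injOn s (box 3 m) (fun x => x + σ)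
          (fun x => ∑ y ∈ box 3 m, (bondPercolation (zdGraph 3) p).real
            (openConnIn (↑(box 3 N) : Set (Site 3)) (x + a) (y + b)))
          (fun _ _ => Finset.sum_nonneg fun _ _ => measureReal_nonneg) hσ
          (fun x _ x' _ h => add_right_cancel h)

/-- For `t ∈ {0, 1}`: `-(2n+1) ≤ (2n+1)(t - 1) ≤ 0` (the offsets of the two lower slabs). [folklore] -/
theorem offset_bounds_low (n : ℕ) (t : ℤ) (ht0 : 0 ≤ t) (ht1 : t ≤ 1) :
    -(2 * (n : ℤ) + 1) ≤ (2 * (n : ℤ) + 1) * (t - 1) ∧ (2 * (n : ℤ) + 1) * (t - 1) ≤ 0 := by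
  interval_cases t <;> omega

/-- The straddling translate `B(n) + c'`, `c' = c_v + (n+1) e_i`, lies in `B(3n+1)` when `v_i ≤ 1`:
coordinate `i` ranges over `(2n+1)(v_i - 1) + [1, 2n+1] ⊆ [-2n, 2n+1]`, the others over
`(2n+1)(v_j - 1) + [-n, n] ⊆ [-3n-1, 3n+1]`. [folklore] -/
theorem add_straddle_mem_box (n : ℕ) (i : Fin 3) (v : Fin 3 → Fin 3) (hv : (v i : ℕ) ≤ 1) :
    ∀ w ∈ box 3 n, (w + fun j => (2 * (n : ℤ) + 1) * (((v j : ℕ) : ℤ) - 1) +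
        if j = i then ((n : ℤ) + 1) else 0) ∈ box 3 (3 * n + 1) := by
  intro w hw
  rw [mem_box] at hw ⊢
  intro j
  obtain ⟨h1, h2⟩ := hw j
  have hv3 := (v j).isLt
  simp only [Pi.add_apply]
  by_cases hj : j = i
  · subst hj
    obtain ⟨h3, h4⟩ := offset_bounds_low n ((v j : ℕ) : ℤ) (by omega) (by omega)
    rw [if_pos rfl]
    constructor <;> omega
  · obtain ⟨h3, h4⟩ := offset_bounds n ((v j : ℕ) : ℤ) (by omega) (by omega)
    rw [if_neg hj]
    constructor <;> omega

/-- `x ↦ x + (n+1) e_i` maps `{x ∈ B(n) : x_i ≤ -1}` into `B(n)` (coordinate `i` lands in `[1, n]`).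
[folklore] -/
theorem add_up_mem_box (n : ℕ) (i : Fin 3) :
    ∀ x ∈ (box 3 n).filter (fun x : Site 3 => x i ≤ -1),
      (x + fun j => if j = i then ((n : ℤ) + 1) else 0) ∈ box 3 n := by
  intro x hx
  rw [Finset.mem_filter, mem_box] at hx
  obtain ⟨hx, hxi⟩ := hx
  rw [mem_box]
  intro j
  obtain ⟨h1, h2⟩ := hx j
  simp only [Pi.add_apply]
  by_cases hj : j = i
  · subst hj
    rw [if_pos rfl]
    constructor <;> omega
  · rw [if_neg hj]
    constructor <;> omega

/-- `y ↦ y - n e_i` maps `{y ∈ B(n) : 0 ≤ y_i}` into `B(n)` (coordinate `i` lands in `[-n, 0]`).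
[folklore] -/
theorem add_down_mem_box (n : ℕ) (i : Fin 3) :
    ∀ y ∈ (box 3 n).filter (fun y : Site 3 => 0 ≤ y i),
      (y + fun j => if j = i then (-(n : ℤ)) else 0) ∈ box 3 n := by
  intro y hy
  rw [Finset.mem_filter, mem_box] at hy
  obtain ⟨hy, hyi⟩ := hy
  rw [mem_box]
  intro j
  obtain ⟨h1, h2⟩ := hy j
  simp only [Pi.add_apply]
  by_cases hj : j = i
  · subst hj
    rw [if_pos rfl]
    constructor <;> omega
  · rw [if_neg hj]
    constructor <;> omega

end InterfaceCrossMass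

open InterfaceCrossMass

/-- **stub_interfaceCrossMass (ONE-INTERFACE cross mass; every `p`, `n`, `i`, `v` with `v_i ≤ 1`;
line `Sketch-r2-ideator5` of crux `FreeBoxPowerSaving`).**  With `c_v = (2n+1)(v-1)` (the sub-box
offsets of `stub_subBoxesSuperadditive`) and the straddling offset `c' = c_v + (n+1) e_i`:
`X^{(i)}(n) = Σ_{x_i ≤ -1, 0 ≤ y_i} P(x ↔ y in B(n)) = Σ P(x + c' ↔ y + c' in B(n) + c')`
(`PairSumShift.real_openConnIn_add_box`) `≤ Σ P(x + c' ↔ y + c' in B(3n+1))` (`openConnIn_mono`: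
`B(n) + c' ⊆ B(3n+1)` because `v_i ≤ 1`), and re-indexing `x + c' = (x + (n+1) e_i) + c_v`,
`y + c' = (y - n e_i) + c_v + (2n+1) e_i` with `x + (n+1) e_i, y - n e_i ∈ B(n)` injectively embeds the
straddling pairs into `B(n) × B(n)` (non-negative terms dropped; `cross_sum_le`;
Grimmett 1999, §1.6). [folklore] -/
theorem stub_interfaceCrossMass :
    ∀ (p : unitInterval) (n : ℕ) (i : Fin 3) (v : Fin 3 → Fin 3), (v i : ℕ) ≤ 1 →
      (∑ x ∈ (box 3 n).filter (fun x : Site 3 => x i ≤ -1), ∑ y ∈ (box 3 n).filter (fun y : Site 3 => 0 ≤ y i),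
          (bondPercolation (zdGraph 3) p).real (openConnIn (↑(box 3 n) : Set (Site 3)) x y)) ≤
      ∑ x ∈ box 3 n, ∑ y ∈ box 3 n,
        (bondPercolation (zdGraph 3) p).real (openConnIn (↑(box 3 (3 * n + 1)) : Set (Site 3))
          (x + fun j => (2 * (n : ℤ) + 1) * (((v j : ℕ) : ℤ) - 1))
          (y + fun j => (2 * (n : ℤ) + 1) * (((v j : ℕ) : ℤ) - 1) + if j = i then (2 * (n : ℤ) + 1) else 0)) := by
  intro p n i v hv
  exact cross_sum_le p ((box 3 n).filter (fun x : Site 3 => x i ≤ -1))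
    ((box 3 n).filter (fun y : Site 3 => 0 ≤ y i))
    (fun j => (2 * (n : ℤ) + 1) * (((v j : ℕ) : ℤ) - 1))
    (fun j => (2 * (n : ℤ) + 1) * (((v j : ℕ) : ℤ) - 1) + if j = i then (2 * (n : ℤ) + 1) else 0)
    (fun j => if j = i then ((n : ℤ) + 1) else 0)
    (fun j => if j = i then (-(n : ℤ)) else 0)
    (fun j => (2 * (n : ℤ) + 1) * (((v j : ℕ) : ℤ) - 1) + if j = i then ((n : ℤ) + 1) else 0)
    (add_up_mem_box n i) (add_down_mem_box n i)
    (by funext j; simp only [Pi.add_apply]; split_ifs <;> ring)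
    (by funext j; simp only [Pi.add_apply]; split_ifs <;> ring)
    (add_straddle_mem_box n i v hv)

end Summit.CriticalPhenomena.PercolationContinuityZ3.FreeBoxPowerSavingLine

end
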